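import Summits.HubbardSuperconductivity.HubbardSuperconductivity.Theorems.AnisotropyChordResolventGramTPBranch

/-!
# Route `AnisotropyChord`: TP₂ of the Gram kernel along the ground branch of a rank-one family
# (complex Hermitian form of LEMMA TP₂ = the engine of COROLLARY TP-W2 of the theory seat
# `hubbard-h0-rotor-theory-1`, cycle 6 — abstract linear algebra, no lattice)

Setting of `…ResolventGramTPBranch` (`L ⪰ 0`, `L e = 0`, `⟨e,s⟩ ≠ 0`, `L`-invariant `𝓜 ∋ e, s`;
states `ψᵢ ∈ 𝓜` on the ground branch of `L + σ|s⟩⟨s|`: `L ψᵢ + σᵢ⟨s,ψᵢ⟩ s = εᵢ ψᵢ`, `σᵢ > 0`,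
`⟨s,ψᵢ⟩ ≠ 0`, variational + uniqueness property of `εᵢ` on `𝓜 ∩ s^⊥`).  By
`rankOne_branch_dotProduct`, `⟨ψᵢ, ψₖ⟩ = conj(cᵢ) cₖ K(εᵢ, εₖ)` with the Cauchy–Gram kernel `K` of the
pair `(L, s)`, all `εᵢ` in the first gap `(0, λ_min⁺)` of the cyclic spectrum; hence:

* `gram_tp2_of_rankOne_branch` — **TP₂**: `ε₂ ≤ ε₁` (rows), `ε₄ ≤ ε₃` (columns) ⇒
  `|⟨ψ₁,ψ₄⟩| |⟨ψ₂,ψ₃⟩| ≤ |⟨ψ₁,ψ₃⟩| |⟨ψ₂,ψ₄⟩|` (`cauchyGram_minor_nonneg`).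
* `gram_tp2_flat_column_of_rankOne_branch` — the kernel vector `e` (the `σ = 0` end point of the
  branch) as last column: `|⟨ψ₁,e⟩| |⟨ψ₂,ψ₃⟩| ≤ |⟨ψ₁,ψ₃⟩| |⟨ψ₂,e⟩|` for `ε₂ ≤ ε₁`
  (`cauchyGram_mul_mono`).
* `overlap_mono_of_rankOne_branch` — **overlap monotonicity** along the branch: `ε₂ ≤ ε₁`,
  `ε_φ ≤ ε₂` ⇒ `|⟨ψ₁, φ⟩| ≤ |⟨ψ₂, φ⟩|` (TP₂ with unit diagonal + Cauchy–Schwarz; the theory seat's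
  `overlapMonotone_of_gramTP2`).

On the ground branch `ε` is increasing in the coupling `σ`, so in the two-magnon application
(`σ ∝ 1 − Δ`) rows/columns are ordered by DEcreasing anisotropy `Δ`.  Theory seat memo
ROTOR-THEORY-6 §52 (COROLLARY TP-W2), §56 P-2/P-3; S. Karlin, *Total Positivity* (1968) Ch. 3;
B. Simon, *Trace Ideals* (2005) §11.  No definition is introduced.
-/

set_option linter.dupNamespace false

noncomputable section

namespace Summit.HubbardSuperconductivity.HubbardSuperconductivity.Theorems.AnisotropyChord

open Matrix Complex Finset
open scoped ComplexOrder InnerProductSpace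
open Literature.MathematicalPhysics.QuantumLattice

variable {ι : Type*} [Fintype ι] [DecidableEq ι]

/-- **TP₂ of the Gram kernel along the ground branch of a rank-one family** (complex Hermitian form
of LEMMA TP₂; see the module docstring).  Four states `ψᵢ` on the branch of `L + σ|s⟩⟨s|` on `𝓜`
with `ε₂ ≤ ε₁` and `ε₄ ≤ ε₃`: `|⟨ψ₁,ψ₄⟩| |⟨ψ₂,ψ₃⟩| ≤ |⟨ψ₁,ψ₃⟩| |⟨ψ₂,ψ₄⟩|`.  Theory seat memo
ROTOR-THEORY-6 §52; Karlin (1968) Ch. 3; Simon, *Trace Ideals* §11. [folklore] -/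
theorem gram_tp2_of_rankOne_branch {L : Matrix ι ι ℂ} (hL : L.PosSemidef)
    (𝓜 : Submodule ℂ (ι → ℂ)) (h𝓜 : ∀ v ∈ 𝓜, L *ᵥ v ∈ 𝓜)
    {e s : ι → ℂ} (he𝓜 : e ∈ 𝓜) (hs𝓜 : s ∈ 𝓜)
    (hLe : L *ᵥ e = 0) (he1 : star e ⬝ᵥ e = 1) (ha0 : star e ⬝ᵥ s ≠ 0)
    {ψ₁ ψ₂ ψ₃ ψ₄ : ι → ℂ} {σ₁ σ₂ σ₃ σ₄ ε₁ ε₂ ε₃ ε₄ : ℝ}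
    (hψ₁𝓜 : ψ₁ ∈ 𝓜) (hσ₁ : 0 < σ₁)
    (h₁ : L *ᵥ ψ₁ + ((σ₁ : ℂ) * (star s ⬝ᵥ ψ₁)) • s = (ε₁ : ℂ) • ψ₁) (hψ₁n : star ψ₁ ⬝ᵥ ψ₁ = 1)
    (hb₁ : star s ⬝ᵥ ψ₁ ≠ 0)
    (hvar₁ : ∀ f ∈ 𝓜, star s ⬝ᵥ f = 0 → ε₁ * (star f ⬝ᵥ f).re ≤ (star f ⬝ᵥ (L *ᵥ f)).re)
    (huniq₁ : ∀ g ∈ 𝓜, star s ⬝ᵥ g = 0 → L *ᵥ g = (ε₁ : ℂ) • g → g = 0)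
    (hψ₂𝓜 : ψ₂ ∈ 𝓜) (hσ₂ : 0 < σ₂)
    (h₂ : L *ᵥ ψ₂ + ((σ₂ : ℂ) * (star s ⬝ᵥ ψ₂)) • s = (ε₂ : ℂ) • ψ₂) (hψ₂n : star ψ₂ ⬝ᵥ ψ₂ = 1)
    (hb₂ : star s ⬝ᵥ ψ₂ ≠ 0)
    (hvar₂ : ∀ f ∈ 𝓜, star s ⬝ᵥ f = 0 → ε₂ * (star f ⬝ᵥ f).re ≤ (star f ⬝ᵥ (L *ᵥ f)).re)
    (huniq₂ : ∀ g ∈ 𝓜, star s ⬝ᵥ g = 0 → L *ᵥ g = (ε₂ : ℂ) • g → g = 0)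
    (hψ₃𝓜 : ψ₃ ∈ 𝓜) (hσ₃ : 0 < σ₃)
    (h₃ : L *ᵥ ψ₃ + ((σ₃ : ℂ) * (star s ⬝ᵥ ψ₃)) • s = (ε₃ : ℂ) • ψ₃) (hψ₃n : star ψ₃ ⬝ᵥ ψ₃ = 1)
    (hb₃ : star s ⬝ᵥ ψ₃ ≠ 0)
    (hvar₃ : ∀ f ∈ 𝓜, star s ⬝ᵥ f = 0 → ε₃ * (star f ⬝ᵥ f).re ≤ (star f ⬝ᵥ (L *ᵥ f)).re)
    (huniq₃ : ∀ g ∈ 𝓜, star s ⬝ᵥ g = 0 → L *ᵥ g = (ε₃ : ℂ) • g → g = 0)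
    (hψ₄𝓜 : ψ₄ ∈ 𝓜) (hσ₄ : 0 < σ₄)
    (h₄ : L *ᵥ ψ₄ + ((σ₄ : ℂ) * (star s ⬝ᵥ ψ₄)) • s = (ε₄ : ℂ) • ψ₄) (hψ₄n : star ψ₄ ⬝ᵥ ψ₄ = 1)
    (hb₄ : star s ⬝ᵥ ψ₄ ≠ 0)
    (hvar₄ : ∀ f ∈ 𝓜, star s ⬝ᵥ f = 0 → ε₄ * (star f ⬝ᵥ f).re ≤ (star f ⬝ᵥ (L *ᵥ f)).re)
    (huniq₄ : ∀ g ∈ 𝓜, star s ⬝ᵥ g = 0 → L *ᵥ g = (ε₄ : ℂ) • g → g = 0)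
    (h21 : ε₂ ≤ ε₁) (h43 : ε₄ ≤ ε₃) :
    ‖star ψ₁ ⬝ᵥ ψ₄‖ * ‖star ψ₂ ⬝ᵥ ψ₃‖ ≤ ‖star ψ₁ ⬝ᵥ ψ₃‖ * ‖star ψ₂ ⬝ᵥ ψ₄‖ := by
  have hH : L.IsHermitian := hL.1
  obtain ⟨hε₁, gap₁, co₁⟩ := rankOne_branch_state hL 𝓜 h𝓜 he𝓜 hs𝓜 hψ₁𝓜 hLe he1 ha0 hσ₁ h₁ hψ₁n hb₁
    hvar₁ huniq₁
  obtain ⟨hε₂, gap₂, co₂⟩ := rankOne_branch_state hL 𝓜 h𝓜 he𝓜 hs𝓜 hψ₂𝓜 hLe he1 ha0 hσ₂ h₂ hψ₂n hb₂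
    hvar₂ huniq₂
  obtain ⟨hε₃, gap₃, co₃⟩ := rankOne_branch_state hL 𝓜 h𝓜 he𝓜 hs𝓜 hψ₃𝓜 hLe he1 ha0 hσ₃ h₃ hψ₃n hb₃
    hvar₃ huniq₃
  obtain ⟨hε₄, gap₄, co₄⟩ := rankOne_branch_state hL 𝓜 h𝓜 he𝓜 hs𝓜 hψ₄𝓜 hLe he1 ha0 hσ₄ h₄ hψ₄n hb₄
    hvar₄ huniq₄
  set w : ι → ℝ := fun j => ‖star (hH.eigenvectorBasis j : ι → ℂ) ⬝ᵥ s‖ ^ 2 with hwdef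
  set lam : ι → ℝ := hH.eigenvalues with hlamdef
  set K : ℝ → ℝ → ℝ := fun x y => ∑ j, w j / ((lam j - x) * (lam j - y)) with hKdef
  have hform : ∀ {ψ ψ' : ι → ℂ} {c c' : ℂ} {x y : ℝ},
      (∀ j, star (hH.eigenvectorBasis j : ι → ℂ) ⬝ᵥ ψ =
        -c * (star (hH.eigenvectorBasis j : ι → ℂ) ⬝ᵥ s) / ((hH.eigenvalues j : ℂ) - x)) →
      (∀ j, star (hH.eigenvectorBasis j : ι → ℂ) ⬝ᵥ ψ' =
        -c' * (star (hH.eigenvectorBasis j : ι → ℂ) ⬝ᵥ s) / ((hH.eigenvalues j : ℂ) - y)) →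
      0 ≤ K x y → ‖star ψ ⬝ᵥ ψ'‖ = ‖c‖ * ‖c'‖ * K x y := by
    intro ψ ψ' c c' x y hψ hψ' hK
    rw [rankOne_branch_dotProduct hH hψ hψ', norm_star_mul_mul_ofReal c c' hK]
  have hwa : ∀ j, w j ≠ 0 → star (hH.eigenvectorBasis j : ι → ℂ) ⬝ᵥ s ≠ 0 := by
    intro j hj h0; apply hj; simp only [hwdef]; rw [h0, norm_zero, zero_pow two_ne_zero]
  have hKnn : ∀ {x y : ℝ}, 0 < x → 0 < y →
      (∀ j, star (hH.eigenvectorBasis j : ι → ℂ) ⬝ᵥ s ≠ 0 → hH.eigenvalues j ≠ 0 →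
        x < hH.eigenvalues j) →
      (∀ j, star (hH.eigenvectorBasis j : ι → ℂ) ⬝ᵥ s ≠ 0 → hH.eigenvalues j ≠ 0 →
        y < hH.eigenvalues j) → 0 ≤ K x y := by
    intro x y hx hy gx gy
    exact rankOne_branch_kernel_nonneg hH s hx hy fun j hj hl => ⟨gx j hj hl, gy j hj hl⟩
  have hK14 := hKnn hε₁ hε₄ gap₁ gap₄
  have hK23 := hKnn hε₂ hε₃ gap₂ gap₃
  have hK13 := hKnn hε₁ hε₃ gap₁ gap₃
  have hK24 := hKnn hε₂ hε₄ gap₂ gap₄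
  rw [hform co₁ co₄ hK14, hform co₂ co₃ hK23, hform co₁ co₃ hK13, hform co₂ co₄ hK24]
  -- the Cauchy–Gram TP₂ with `E = ε₂ ≤ E' = ε₁`, `F = ε₄ ≤ F' = ε₃`
  have tp := cauchyGram_minor_nonneg w lam (fun j => sq_nonneg _) h21 h43 (fun j hj => by
    have ha := hwa j hj
    by_cases hl : lam j = 0
    · refine ⟨?_, ?_⟩ <;> rw [hl, zero_sub, zero_sub] <;> nlinarith
    · exact ⟨mul_pos (sub_pos.2 (gap₂ j ha hl)) (sub_pos.2 (gap₁ j ha hl)),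
        mul_pos (sub_pos.2 (gap₄ j ha hl)) (sub_pos.2 (gap₃ j ha hl))⟩)
  -- tp : K ε₂ ε₃ * K ε₁ ε₄ ≤ K ε₂ ε₄ * K ε₁ ε₃
  have hpos : 0 ≤ ‖(σ₁ : ℂ) * (star s ⬝ᵥ ψ₁)‖ * ‖(σ₂ : ℂ) * (star s ⬝ᵥ ψ₂)‖ *
      (‖(σ₃ : ℂ) * (star s ⬝ᵥ ψ₃)‖ * ‖(σ₄ : ℂ) * (star s ⬝ᵥ ψ₄)‖) := by positivity
  have key := mul_le_mul_of_nonneg_left tp hpos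
  have e1 : K ε₂ ε₃ * K ε₁ ε₄ = K ε₁ ε₄ * K ε₂ ε₃ := mul_comm _ _
  have e2 : K ε₂ ε₄ * K ε₁ ε₃ = K ε₁ ε₃ * K ε₂ ε₄ := mul_comm _ _
  simp only [hKdef] at key e1 e2 ⊢
  nlinarith [key, e1, e2, hK14, hK23, hK13, hK24]

/-- **TP₂ with the kernel vector as last column** (the `σ = 0` end point of the branch): three
states on the branch with `ε₂ ≤ ε₁` satisfy `|⟨ψ₁,e⟩| |⟨ψ₂,ψ₃⟩| ≤ |⟨ψ₁,ψ₃⟩| |⟨ψ₂,e⟩|`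
(`⟨e,ψᵢ⟩ = σᵢ⟨s,ψᵢ⟩⟨e,s⟩/εᵢ` and `ε ↦ ε K(ε, ε₃)` non-decreasing, `cauchyGram_mul_mono`).
Theory seat memo ROTOR-THEORY-6 §52 (`Δ = 1` by continuity; here directly). [folklore] -/
theorem gram_tp2_flat_column_of_rankOne_branch {L : Matrix ι ι ℂ} (hL : L.PosSemidef)
    (𝓜 : Submodule ℂ (ι → ℂ)) (h𝓜 : ∀ v ∈ 𝓜, L *ᵥ v ∈ 𝓜)
    {e s : ι → ℂ} (he𝓜 : e ∈ 𝓜) (hs𝓜 : s ∈ 𝓜)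
    (hLe : L *ᵥ e = 0) (he1 : star e ⬝ᵥ e = 1) (ha0 : star e ⬝ᵥ s ≠ 0)
    {ψ₁ ψ₂ ψ₃ : ι → ℂ} {σ₁ σ₂ σ₃ ε₁ ε₂ ε₃ : ℝ}
    (hψ₁𝓜 : ψ₁ ∈ 𝓜) (hσ₁ : 0 < σ₁)
    (h₁ : L *ᵥ ψ₁ + ((σ₁ : ℂ) * (star s ⬝ᵥ ψ₁)) • s = (ε₁ : ℂ) • ψ₁) (hψ₁n : star ψ₁ ⬝ᵥ ψ₁ = 1)
    (hb₁ : star s ⬝ᵥ ψ₁ ≠ 0)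
    (hvar₁ : ∀ f ∈ 𝓜, star s ⬝ᵥ f = 0 → ε₁ * (star f ⬝ᵥ f).re ≤ (star f ⬝ᵥ (L *ᵥ f)).re)
    (huniq₁ : ∀ g ∈ 𝓜, star s ⬝ᵥ g = 0 → L *ᵥ g = (ε₁ : ℂ) • g → g = 0)
    (hψ₂𝓜 : ψ₂ ∈ 𝓜) (hσ₂ : 0 < σ₂)
    (h₂ : L *ᵥ ψ₂ + ((σ₂ : ℂ) * (star s ⬝ᵥ ψ₂)) • s = (ε₂ : ℂ) • ψ₂) (hψ₂n : star ψ₂ ⬝ᵥ ψ₂ = 1)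
    (hb₂ : star s ⬝ᵥ ψ₂ ≠ 0)
    (hvar₂ : ∀ f ∈ 𝓜, star s ⬝ᵥ f = 0 → ε₂ * (star f ⬝ᵥ f).re ≤ (star f ⬝ᵥ (L *ᵥ f)).re)
    (huniq₂ : ∀ g ∈ 𝓜, star s ⬝ᵥ g = 0 → L *ᵥ g = (ε₂ : ℂ) • g → g = 0)
    (hψ₃𝓜 : ψ₃ ∈ 𝓜) (hσ₃ : 0 < σ₃)
    (h₃ : L *ᵥ ψ₃ + ((σ₃ : ℂ) * (star s ⬝ᵥ ψ₃)) • s = (ε₃ : ℂ) • ψ₃) (hψ₃n : star ψ₃ ⬝ᵥ ψ₃ = 1)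
    (hb₃ : star s ⬝ᵥ ψ₃ ≠ 0)
    (hvar₃ : ∀ f ∈ 𝓜, star s ⬝ᵥ f = 0 → ε₃ * (star f ⬝ᵥ f).re ≤ (star f ⬝ᵥ (L *ᵥ f)).re)
    (huniq₃ : ∀ g ∈ 𝓜, star s ⬝ᵥ g = 0 → L *ᵥ g = (ε₃ : ℂ) • g → g = 0)
    (h21 : ε₂ ≤ ε₁) :
    ‖star ψ₁ ⬝ᵥ e‖ * ‖star ψ₂ ⬝ᵥ ψ₃‖ ≤ ‖star ψ₁ ⬝ᵥ ψ₃‖ * ‖star ψ₂ ⬝ᵥ e‖ := by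
  have hH : L.IsHermitian := hL.1
  obtain ⟨hε₁, gap₁, co₁⟩ := rankOne_branch_state hL 𝓜 h𝓜 he𝓜 hs𝓜 hψ₁𝓜 hLe he1 ha0 hσ₁ h₁ hψ₁n hb₁
    hvar₁ huniq₁
  obtain ⟨hε₂, gap₂, co₂⟩ := rankOne_branch_state hL 𝓜 h𝓜 he𝓜 hs𝓜 hψ₂𝓜 hLe he1 ha0 hσ₂ h₂ hψ₂n hb₂
    hvar₂ huniq₂
  obtain ⟨hε₃, gap₃, co₃⟩ := rankOne_branch_state hL 𝓜 h𝓜 he𝓜 hs𝓜 hψ₃𝓜 hLe he1 ha0 hσ₃ h₃ hψ₃n hb₃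
    hvar₃ huniq₃
  set w : ι → ℝ := fun j => ‖star (hH.eigenvectorBasis j : ι → ℂ) ⬝ᵥ s‖ ^ 2 with hwdef
  set lam : ι → ℝ := hH.eigenvalues with hlamdef
  set K : ℝ → ℝ → ℝ := fun x y => ∑ j, w j / ((lam j - x) * (lam j - y)) with hKdef
  have hwa : ∀ j, w j ≠ 0 → star (hH.eigenvectorBasis j : ι → ℂ) ⬝ᵥ s ≠ 0 := by
    intro j hj h0; apply hj; simp only [hwdef]; rw [h0, norm_zero, zero_pow two_ne_zero]
  have hK23 : 0 ≤ K ε₂ ε₃ :=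
    rankOne_branch_kernel_nonneg hH s hε₂ hε₃ fun j hj hl => ⟨gap₂ j hj hl, gap₃ j hj hl⟩
  have hK13 : 0 ≤ K ε₁ ε₃ :=
    rankOne_branch_kernel_nonneg hH s hε₁ hε₃ fun j hj hl => ⟨gap₁ j hj hl, gap₃ j hj hl⟩
  have n23 : ‖star ψ₂ ⬝ᵥ ψ₃‖ = ‖(σ₂ : ℂ) * (star s ⬝ᵥ ψ₂)‖ * ‖(σ₃ : ℂ) * (star s ⬝ᵥ ψ₃)‖ * K ε₂ ε₃ := by
    rw [rankOne_branch_dotProduct hH co₂ co₃, norm_star_mul_mul_ofReal _ _ hK23]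
  have n13 : ‖star ψ₁ ⬝ᵥ ψ₃‖ = ‖(σ₁ : ℂ) * (star s ⬝ᵥ ψ₁)‖ * ‖(σ₃ : ℂ) * (star s ⬝ᵥ ψ₃)‖ * K ε₁ ε₃ := by
    rw [rankOne_branch_dotProduct hH co₁ co₃, norm_star_mul_mul_ofReal _ _ hK13]
  have nflat : ∀ {ψ : ι → ℂ} {σ ε : ℝ}, 0 < ε →
      L *ᵥ ψ + ((σ : ℂ) * (star s ⬝ᵥ ψ)) • s = (ε : ℂ) • ψ →
      ‖star ψ ⬝ᵥ e‖ = ‖(σ : ℂ) * (star s ⬝ᵥ ψ)‖ * ‖star e ⬝ᵥ s‖ / ε := by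
    intro ψ σ ε hε h
    rw [star_dotProduct ψ e, norm_star, rankOne_branch_flat_dotProduct hH hLe hε.ne' h, norm_div,
      norm_mul, Complex.norm_real, Real.norm_of_nonneg hε.le]
  rw [nflat hε₁ h₁, nflat hε₂ h₂, n23, n13]
  have mono := cauchyGram_mul_mono w lam (fun j => sq_nonneg _) hε₂ h21 hε₃ (fun j hj => by
    have ha := hwa j hj
    by_cases hl : lam j = 0
    · exact Or.inl hl
    · exact Or.inr ⟨gap₁ j ha hl, gap₃ j ha hl⟩)
  -- mono : ε₂ * K ε₂ ε₃ ≤ ε₁ * K ε₁ ε₃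
  simp only [hKdef] at mono hK23 hK13 ⊢
  have hc : 0 ≤ ‖(σ₁ : ℂ) * (star s ⬝ᵥ ψ₁)‖ * ‖star e ⬝ᵥ s‖ *
      (‖(σ₂ : ℂ) * (star s ⬝ᵥ ψ₂)‖ * ‖(σ₃ : ℂ) * (star s ⬝ᵥ ψ₃)‖) := by positivity
  have step : (∑ j, w j / ((lam j - ε₂) * (lam j - ε₃))) / ε₁ ≤
      (∑ j, w j / ((lam j - ε₁) * (lam j - ε₃))) / ε₂ := by
    rw [div_le_div_iff₀ hε₁ hε₂]
    linarith [mono]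
  have final := mul_le_mul_of_nonneg_left step hc
  have e1 : ‖(σ₁ : ℂ) * (star s ⬝ᵥ ψ₁)‖ * ‖star e ⬝ᵥ s‖ / ε₁ *
      (‖(σ₂ : ℂ) * (star s ⬝ᵥ ψ₂)‖ * ‖(σ₃ : ℂ) * (star s ⬝ᵥ ψ₃)‖ *
        ∑ j, w j / ((lam j - ε₂) * (lam j - ε₃))) =
      ‖(σ₁ : ℂ) * (star s ⬝ᵥ ψ₁)‖ * ‖star e ⬝ᵥ s‖ *
      (‖(σ₂ : ℂ) * (star s ⬝ᵥ ψ₂)‖ * ‖(σ₃ : ℂ) * (star s ⬝ᵥ ψ₃)‖) *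
        ((∑ j, w j / ((lam j - ε₂) * (lam j - ε₃))) / ε₁) := by ring
  have e2 : ‖(σ₁ : ℂ) * (star s ⬝ᵥ ψ₁)‖ * ‖(σ₃ : ℂ) * (star s ⬝ᵥ ψ₃)‖ *
      (∑ j, w j / ((lam j - ε₁) * (lam j - ε₃))) *
        (‖(σ₂ : ℂ) * (star s ⬝ᵥ ψ₂)‖ * ‖star e ⬝ᵥ s‖ / ε₂) =
      ‖(σ₁ : ℂ) * (star s ⬝ᵥ ψ₁)‖ * ‖star e ⬝ᵥ s‖ *
      (‖(σ₂ : ℂ) * (star s ⬝ᵥ ψ₂)‖ * ‖(σ₃ : ℂ) * (star s ⬝ᵥ ψ₃)‖) *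
        ((∑ j, w j / ((lam j - ε₁) * (lam j - ε₃))) / ε₂) := by ring
  rw [e1, e2]
  exact final

/-- **Overlap monotonicity along the branch** (COROLLARY of TP₂ with unit diagonal): for states
`ψ₁, ψ₂, φ` on the branch with `ε₂ ≤ ε₁` and `ε_φ ≤ ε₂` (i.e. couplings `σ₁ ≥ σ₂ ≥ σ_φ` on the
ground branch), `|⟨ψ₁, φ⟩| ≤ |⟨ψ₂, φ⟩|`.  Theory seat memo ROTOR-THEORY-6 §52 (TP₂ ⇒ OM);
`overlapMonotone_of_gramTP2` of its Sketch6. [folklore] -/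
theorem overlap_mono_of_rankOne_branch {L : Matrix ι ι ℂ} (hL : L.PosSemidef)
    (𝓜 : Submodule ℂ (ι → ℂ)) (h𝓜 : ∀ v ∈ 𝓜, L *ᵥ v ∈ 𝓜)
    {e s : ι → ℂ} (he𝓜 : e ∈ 𝓜) (hs𝓜 : s ∈ 𝓜)
    (hLe : L *ᵥ e = 0) (he1 : star e ⬝ᵥ e = 1) (ha0 : star e ⬝ᵥ s ≠ 0)
    {ψ₁ ψ₂ φ : ι → ℂ} {σ₁ σ₂ σ₃ ε₁ ε₂ ε₃ : ℝ}
    (hψ₁𝓜 : ψ₁ ∈ 𝓜) (hσ₁ : 0 < σ₁)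
    (h₁ : L *ᵥ ψ₁ + ((σ₁ : ℂ) * (star s ⬝ᵥ ψ₁)) • s = (ε₁ : ℂ) • ψ₁) (hψ₁n : star ψ₁ ⬝ᵥ ψ₁ = 1)
    (hb₁ : star s ⬝ᵥ ψ₁ ≠ 0)
    (hvar₁ : ∀ f ∈ 𝓜, star s ⬝ᵥ f = 0 → ε₁ * (star f ⬝ᵥ f).re ≤ (star f ⬝ᵥ (L *ᵥ f)).re)
    (huniq₁ : ∀ g ∈ 𝓜, star s ⬝ᵥ g = 0 → L *ᵥ g = (ε₁ : ℂ) • g → g = 0)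
    (hψ₂𝓜 : ψ₂ ∈ 𝓜) (hσ₂ : 0 < σ₂)
    (h₂ : L *ᵥ ψ₂ + ((σ₂ : ℂ) * (star s ⬝ᵥ ψ₂)) • s = (ε₂ : ℂ) • ψ₂) (hψ₂n : star ψ₂ ⬝ᵥ ψ₂ = 1)
    (hb₂ : star s ⬝ᵥ ψ₂ ≠ 0)
    (hvar₂ : ∀ f ∈ 𝓜, star s ⬝ᵥ f = 0 → ε₂ * (star f ⬝ᵥ f).re ≤ (star f ⬝ᵥ (L *ᵥ f)).re)
    (huniq₂ : ∀ g ∈ 𝓜, star s ⬝ᵥ g = 0 → L *ᵥ g = (ε₂ : ℂ) • g → g = 0)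
    (hφ𝓜 : φ ∈ 𝓜) (hσ₃ : 0 < σ₃)
    (h₃ : L *ᵥ φ + ((σ₃ : ℂ) * (star s ⬝ᵥ φ)) • s = (ε₃ : ℂ) • φ) (hφn : star φ ⬝ᵥ φ = 1)
    (hb₃ : star s ⬝ᵥ φ ≠ 0)
    (hvar₃ : ∀ f ∈ 𝓜, star s ⬝ᵥ f = 0 → ε₃ * (star f ⬝ᵥ f).re ≤ (star f ⬝ᵥ (L *ᵥ f)).re)
    (huniq₃ : ∀ g ∈ 𝓜, star s ⬝ᵥ g = 0 → L *ᵥ g = (ε₃ : ℂ) • g → g = 0)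
    (h21 : ε₂ ≤ ε₁) (h32 : ε₃ ≤ ε₂) :
    ‖star ψ₁ ⬝ᵥ φ‖ ≤ ‖star ψ₂ ⬝ᵥ φ‖ := by
  have tp := gram_tp2_of_rankOne_branch hL 𝓜 h𝓜 he𝓜 hs𝓜 hLe he1 ha0
    hψ₁𝓜 hσ₁ h₁ hψ₁n hb₁ hvar₁ huniq₁ hψ₂𝓜 hσ₂ h₂ hψ₂n hb₂ hvar₂ huniq₂
    hψ₂𝓜 hσ₂ h₂ hψ₂n hb₂ hvar₂ huniq₂ hφ𝓜 hσ₃ h₃ hφn hb₃ hvar₃ huniq₃ h21 h32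
  -- tp : ‖⟨ψ₁,φ⟩‖ ‖⟨ψ₂,ψ₂⟩‖ ≤ ‖⟨ψ₁,ψ₂⟩‖ ‖⟨ψ₂,φ⟩‖
  rw [hψ₂n, norm_one, mul_one] at tp
  have hcs : ‖star ψ₁ ⬝ᵥ ψ₂‖ ≤ 1 := norm_star_dotProduct_le_one hψ₁n hψ₂n
  calc ‖star ψ₁ ⬝ᵥ φ‖ ≤ ‖star ψ₁ ⬝ᵥ ψ₂‖ * ‖star ψ₂ ⬝ᵥ φ‖ := tp
    _ ≤ 1 * ‖star ψ₂ ⬝ᵥ φ‖ := by gcongr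
    _ = ‖star ψ₂ ⬝ᵥ φ‖ := one_mul _

/-- **The flat corner** (both end points): for two states `ψ₁, ψ₃` on the branch,
`|⟨ψ₁, e⟩| |⟨e, ψ₃⟩| ≤ |⟨ψ₁, ψ₃⟩|` — the `2 × 2` minor with the kernel vector `e` as second row AND
second column.  (`K(ε₁,ε₃) ≥ Σ_{λ_j = 0} |⟨v_j,s⟩|²/(ε₁ε₃) ≥ |⟨e,s⟩|²/(ε₁ε₃)`, Bessel for the unit
kernel vector `e`.) [folklore] -/
theorem gram_flat_corner_of_rankOne_branch {L : Matrix ι ι ℂ} (hL : L.PosSemidef)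
    (𝓜 : Submodule ℂ (ι → ℂ)) (h𝓜 : ∀ v ∈ 𝓜, L *ᵥ v ∈ 𝓜)
    {e s : ι → ℂ} (he𝓜 : e ∈ 𝓜) (hs𝓜 : s ∈ 𝓜)
    (hLe : L *ᵥ e = 0) (he1 : star e ⬝ᵥ e = 1) (ha0 : star e ⬝ᵥ s ≠ 0)
    {ψ₁ ψ₃ : ι → ℂ} {σ₁ σ₃ ε₁ ε₃ : ℝ}
    (hψ₁𝓜 : ψ₁ ∈ 𝓜) (hσ₁ : 0 < σ₁)
    (h₁ : L *ᵥ ψ₁ + ((σ₁ : ℂ) * (star s ⬝ᵥ ψ₁)) • s = (ε₁ : ℂ) • ψ₁) (hψ₁n : star ψ₁ ⬝ᵥ ψ₁ = 1)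
    (hb₁ : star s ⬝ᵥ ψ₁ ≠ 0)
    (hvar₁ : ∀ f ∈ 𝓜, star s ⬝ᵥ f = 0 → ε₁ * (star f ⬝ᵥ f).re ≤ (star f ⬝ᵥ (L *ᵥ f)).re)
    (huniq₁ : ∀ g ∈ 𝓜, star s ⬝ᵥ g = 0 → L *ᵥ g = (ε₁ : ℂ) • g → g = 0)
    (hψ₃𝓜 : ψ₃ ∈ 𝓜) (hσ₃ : 0 < σ₃)
    (h₃ : L *ᵥ ψ₃ + ((σ₃ : ℂ) * (star s ⬝ᵥ ψ₃)) • s = (ε₃ : ℂ) • ψ₃) (hψ₃n : star ψ₃ ⬝ᵥ ψ₃ = 1)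
    (hb₃ : star s ⬝ᵥ ψ₃ ≠ 0)
    (hvar₃ : ∀ f ∈ 𝓜, star s ⬝ᵥ f = 0 → ε₃ * (star f ⬝ᵥ f).re ≤ (star f ⬝ᵥ (L *ᵥ f)).re)
    (huniq₃ : ∀ g ∈ 𝓜, star s ⬝ᵥ g = 0 → L *ᵥ g = (ε₃ : ℂ) • g → g = 0) :
    ‖star ψ₁ ⬝ᵥ e‖ * ‖star e ⬝ᵥ ψ₃‖ ≤ ‖star ψ₁ ⬝ᵥ ψ₃‖ := by
  have hH : L.IsHermitian := hL.1
  obtain ⟨hε₁, gap₁, co₁⟩ := rankOne_branch_state hL 𝓜 h𝓜 he𝓜 hs𝓜 hψ₁𝓜 hLe he1 ha0 hσ₁ h₁ hψ₁n hb₁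
    hvar₁ huniq₁
  obtain ⟨hε₃, gap₃, co₃⟩ := rankOne_branch_state hL 𝓜 h𝓜 he𝓜 hs𝓜 hψ₃𝓜 hLe he1 ha0 hσ₃ h₃ hψ₃n hb₃
    hvar₃ huniq₃
  set v : ι → (ι → ℂ) := fun j => (hH.eigenvectorBasis j : ι → ℂ) with hvdef
  set lam : ι → ℝ := hH.eigenvalues with hlamdef
  set w : ι → ℝ := fun j => ‖star (v j) ⬝ᵥ s‖ ^ 2 with hwdef
  set K : ℝ := ∑ j, w j / ((lam j - ε₁) * (lam j - ε₃)) with hKdef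
  have hK : 0 ≤ K :=
    rankOne_branch_kernel_nonneg hH s hε₁ hε₃ fun j hj hl => ⟨gap₁ j hj hl, gap₃ j hj hl⟩
  have n13 : ‖star ψ₁ ⬝ᵥ ψ₃‖ = ‖(σ₁ : ℂ) * (star s ⬝ᵥ ψ₁)‖ * ‖(σ₃ : ℂ) * (star s ⬝ᵥ ψ₃)‖ * K := by
    rw [rankOne_branch_dotProduct hH co₁ co₃, norm_star_mul_mul_ofReal _ _ hK]
  have n1 : ‖star ψ₁ ⬝ᵥ e‖ = ‖(σ₁ : ℂ) * (star s ⬝ᵥ ψ₁)‖ * ‖star e ⬝ᵥ s‖ / ε₁ := by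
    rw [star_dotProduct ψ₁ e, norm_star, rankOne_branch_flat_dotProduct hH hLe hε₁.ne' h₁, norm_div,
      norm_mul, Complex.norm_real, Real.norm_of_nonneg hε₁.le]
  have n3 : ‖star e ⬝ᵥ ψ₃‖ = ‖(σ₃ : ℂ) * (star s ⬝ᵥ ψ₃)‖ * ‖star e ⬝ᵥ s‖ / ε₃ := by
    rw [rankOne_branch_flat_dotProduct hH hLe hε₃.ne' h₃, norm_div, norm_mul, Complex.norm_real,
      Real.norm_of_nonneg hε₃.le]
  -- kernel coefficients of `e` vanish off `λ = 0`
  have hcoef : ∀ j x, star (v j) ⬝ᵥ (L *ᵥ x) = (lam j : ℂ) * (star (v j) ⬝ᵥ x) :=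
    fun j x => eigenvector_dotProduct_mulVec_self hH j x
  have heperp : ∀ j, lam j ≠ 0 → star (v j) ⬝ᵥ e = 0 := by
    intro j hj
    have h := hcoef j e
    rw [hLe, dotProduct_zero] at h
    rcases mul_eq_zero.1 h.symm with h1 | h1
    · exact absurd (by exact_mod_cast h1 : lam j = 0) hj
    · exact h1
  -- Bessel: `|⟨e,s⟩|² ≤ Σ_{λ_j = 0} w_j`
  set x : ι → ℝ := fun j => ‖star (v j) ⬝ᵥ e‖ with hxdef
  set y : ι → ℝ := fun j => if lam j = 0 then ‖star (v j) ⬝ᵥ s‖ else 0 with hydef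
  have hxy : ∀ j, ‖star (star (v j) ⬝ᵥ e) * (star (v j) ⬝ᵥ s)‖ = x j * y j := by
    intro j
    by_cases hl : lam j = 0
    · simp only [hxdef, hydef, hl, if_true, norm_mul, norm_star]
    · simp only [hxdef, hydef, hl, if_false, heperp j hl, star_zero, zero_mul, norm_zero, mul_zero]
  have ha0le : ‖star e ⬝ᵥ s‖ ≤ ∑ j, x j * y j := by
    rw [star_dotProduct_eq_sum_coord hH.eigenvectorBasis e s]
    refine (norm_sum_le _ _).trans (le_of_eq (Finset.sum_congr rfl fun j _ => hxy j))
  have hx2 : ∑ j, x j ^ 2 = 1 := by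
    rw [hxdef]
    have h := re_star_dotProduct_self_eq_sum hH.eigenvectorBasis e
    rw [he1, Complex.one_re] at h
    exact h.symm
  have hy2 : ∀ j, y j ^ 2 = if lam j = 0 then w j else 0 := by
    intro j
    by_cases hl : lam j = 0 <;> simp [hydef, hwdef, hl]
  have bessel : ‖star e ⬝ᵥ s‖ ^ 2 ≤ ∑ j, (if lam j = 0 then w j else 0) := by
    have cs := Finset.sum_mul_sq_le_sq_mul_sq Finset.univ x y
    rw [hx2, one_mul] at cs
    have h0 : 0 ≤ ∑ j, x j * y j := le_trans (norm_nonneg _) ha0le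
    calc ‖star e ⬝ᵥ s‖ ^ 2 ≤ (∑ j, x j * y j) ^ 2 := pow_le_pow_left₀ (norm_nonneg _) ha0le 2
      _ ≤ ∑ j, y j ^ 2 := cs
      _ = ∑ j, (if lam j = 0 then w j else 0) := Finset.sum_congr rfl fun j _ => hy2 j
  -- `K ≥ Σ_{λ=0} w / (ε₁ε₃)`
  have hKge : (∑ j, (if lam j = 0 then w j else 0)) / (ε₁ * ε₃) ≤ K := by
    rw [hKdef, Finset.sum_div]
    refine Finset.sum_le_sum fun j _ => ?_
    by_cases hl : lam j = 0
    · rw [if_pos hl, hl, zero_sub, zero_sub, neg_mul_neg]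
    · rw [if_neg hl, zero_div]
      by_cases hj : w j = 0
      · rw [hj, zero_div]
      · have ha : star (v j) ⬝ᵥ s ≠ 0 := by
          intro h0; apply hj; simp only [hwdef]; rw [h0, norm_zero, zero_pow two_ne_zero]
        exact div_nonneg (sq_nonneg _)
          (mul_pos (sub_pos.2 (gap₁ j ha hl)) (sub_pos.2 (gap₃ j ha hl))).le
  rw [n1, n3, n13]
  have hc : 0 ≤ ‖(σ₁ : ℂ) * (star s ⬝ᵥ ψ₁)‖ * ‖(σ₃ : ℂ) * (star s ⬝ᵥ ψ₃)‖ := by positivity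
  have step : ‖star e ⬝ᵥ s‖ * ‖star e ⬝ᵥ s‖ / (ε₁ * ε₃) ≤ K := by
    refine le_trans ?_ hKge
    rw [← pow_two]
    exact div_le_div_of_nonneg_right bessel (mul_pos hε₁ hε₃).le
  have final := mul_le_mul_of_nonneg_left step hc
  have e1 : ‖(σ₁ : ℂ) * (star s ⬝ᵥ ψ₁)‖ * ‖star e ⬝ᵥ s‖ / ε₁ *
      (‖(σ₃ : ℂ) * (star s ⬝ᵥ ψ₃)‖ * ‖star e ⬝ᵥ s‖ / ε₃) =
      ‖(σ₁ : ℂ) * (star s ⬝ᵥ ψ₁)‖ * ‖(σ₃ : ℂ) * (star s ⬝ᵥ ψ₃)‖ *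
        (‖star e ⬝ᵥ s‖ * ‖star e ⬝ᵥ s‖ / (ε₁ * ε₃)) := by
    field_simp
  rw [e1]
  exact final

end Summit.HubbardSuperconductivity.HubbardSuperconductivity.Theorems.AnisotropyChord
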